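import Summits.NavierStokesRegularity.NavierStokesRegularity.Theses.RellichScar
import Summits.NavierStokesRegularity.NavierStokesRegularity.Theorems.ScarRigidity.Negative.LogicAndLoadBearing
import Literature.Analysis.FluidPDE.TypeIAncientMild
import Literature.Analysis.FluidPDE.ParasiticSlabFlow
import Summits.NavierStokesRegularity.NavierStokesRegularity.Theorems.RellichScarScarRigidityCoulombPotential
import HarnessLib

/-!
# `ScarRigidity` — line `finite-energy-log-convexity`, stub `stub_coulombEnergyPackage`:
# Poisson's equation for the Newtonian potential of an apex density (crux stmt-NavierStokesRegularity-11717)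

Helper file 4 of S4-E (`stub_coulombEnergyPackage`), continuing `…CoulombPotential`: for a `C²`
density `w : ℝ³ → ℝ³` with `‖w(y)‖ ≤ A/(‖y‖ + a)³` (`a > 0`) the Newtonian potential
`ψ(x) = ∫ Γ(x - y) w(y) dy` (`Γ = newtonKernel = -1/(4π|z|)`) is `C²` with `Δψ = w`:

* `newtonFar_potential_regularity` — the far part `ψ∞ = ∫ Γ∞(· - y) w(y) dy` is `C²`, with
  `∂_b ψ∞ = ∫ ∂_bΓ∞(· - y) w`, `∂_c∂_b ψ∞ = ∫ ∂_c∂_bΓ∞(· - y) w`, `Δψ∞ = ∫ λ(· - y) w` (`λ = ΔΓ∞`);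
* `newtonPotential_eq_near_add_far` — `ψ = ψ₀ + ψ∞`, `ψ₀(x) = ∫ Γ₀(z) w(x - z) dz`;
* `contDiff_two_newtonPotential`, `laplacian_newtonPotential` — **`ψ ∈ C²`, `Δψ = w`**
  (`Δψ₀ = w - λ ⋆ w`, `Δψ∞ = λ ⋆ w`; Gilbarg–Trudinger (2.17), Lemma 4.2);
* `fderiv_newtonPotential_apply`, `fderiv_fderiv_newtonPotential_apply` — the first two derivatives
  as near integrals on the density plus far integrals on the kernel.
-/

noncomputable section

open Set Filter Function MeasureTheory Metric TopologicalSpace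
open scoped Topology ENNReal NNReal InnerProductSpace RealInnerProductSpace
open Literature.Analysis.FluidPDE
open Summit.NavierStokesRegularity.NavierStokesRegularity.Theses.RellichScar
open Summit.NavierStokesRegularity.NavierStokesRegularity.Theorems.ScarRigidity.Negative

set_option linter.dupNamespace false

namespace Summit.NavierStokesRegularity.NavierStokesRegularity.Theorems.RellichScarScarRigidity

open Real
open scoped Laplacian

/-! ## The far part is `C²` -/

/-- Integrability of a continuous integrand dominated by `M (1+‖x-y‖)⁻² ρ(y)⁻³`. [folklore] -/
theorem integrable_of_norm_le_weight {F : Type*} [NormedAddCommGroup F]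
    {f : (EuclideanSpace ℝ (Fin 3)) → F} (hf : Continuous f) (x : EuclideanSpace ℝ (Fin 3))
    {a M : ℝ} (ha : 0 < a)
    (hle : ∀ y, ‖f y‖ ≤ M * (((1 + ‖x - y‖) ^ 2)⁻¹ * ((‖y‖ + a) ^ 3)⁻¹)) :
    Integrable f volume :=
  (((integrable_inv_pow_mul_inv_cube x ha (le_refl 2)).1).const_mul M).mono' hf.aestronglyMeasurable
    (Eventually.of_forall hle)

/-- **The far part of the Newtonian potential of an apex density is `C²`**, with derivatives under
the integral sign on the kernel: `∂_b ψ∞(x) = ∫ ∂_bΓ∞(x-y) w(y) dy`,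
`∂_c∂_b ψ∞(x) = ∫ ∂_c∂_bΓ∞(x-y) w(y) dy`, `Δψ∞(x) = ∫ λ(x-y) w(y) dy`
(`hasFDerivAt_integral_kernel_sub_smul` for `Γ∞` and for `∂_bΓ∞`). [folklore] -/
theorem newtonFar_potential_regularity
    {w : (EuclideanSpace ℝ (Fin 3)) → (EuclideanSpace ℝ (Fin 3))} (hwc : Continuous w)
    {A a : ℝ} (ha : 0 < a) (hA : 0 ≤ A) (hwb : ∀ y, ‖w y‖ ≤ A * ((‖y‖ + a) ^ 3)⁻¹) :
    ContDiff ℝ 2 (fun x => ∫ y, newtonFar 1 2 (x - y) • w y) ∧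
    (∀ x b, fderiv ℝ (fun x => ∫ y, newtonFar 1 2 (x - y) • w y) x b =
      ∫ y, fderiv ℝ (newtonFar 1 2) (x - y) b • w y) ∧
    (∀ x b c, fderiv ℝ (fun x => fderiv ℝ (fun x => ∫ y, newtonFar 1 2 (x - y) • w y) x b) x c =
      ∫ y, fderiv ℝ (fun z => fderiv ℝ (newtonFar 1 2) z b) (x - y) c • w y) ∧
    (∀ x, (Δ (fun x => ∫ y, newtonFar 1 2 (x - y) • w y)) x =
      ∫ y, newtonFarLaplacian 1 2 (x - y) • w y) := by
  obtain ⟨K₀, K₁, K₂, hK₀, hK₁, hK₂, hb0, hb1, hb1', hb2⟩ := exists_newtonFar_kernel_bounds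
  have hΓ : ContDiff ℝ 2 (newtonFar (1 : ℝ) 2) := contDiff_newtonFar one_pos one_lt_two
  have hΓ1 : ContDiff ℝ 1 (newtonFar (1 : ℝ) 2) := hΓ.of_le one_le_two
  -- the directional derivatives of the far kernel
  set kb : (EuclideanSpace ℝ (Fin 3)) → (EuclideanSpace ℝ (Fin 3)) → ℝ :=
    fun b z => fderiv ℝ (newtonFar 1 2) z b with hkb_def
  have hkb : ∀ b, ContDiff ℝ 1 (kb b) := fun b =>
    (hΓ.fderiv_right (m := 1) le_rfl).clm_apply contDiff_const
  -- level 0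
  set ψf : (EuclideanSpace ℝ (Fin 3)) → (EuclideanSpace ℝ (Fin 3)) :=
    fun x => ∫ y, newtonFar 1 2 (x - y) • w y with hψf
  have L0 := fun x => hasFDerivAt_integral_kernel_sub_smul hΓ1 hK₀ hK₁ hb0 hb1 hwc ha hA hwb x
  -- level 1
  have L1 := fun b x => hasFDerivAt_integral_kernel_sub_smul (hkb b) (mul_nonneg hK₁ (norm_nonneg b))
    (mul_nonneg hK₂ (norm_nonneg b)) (hb1' · b) (hb2 · b) hwc ha hA hwb x
  -- integrability of the applied integrands
  have hI1 : ∀ x, Integrable (fun y => (fderiv ℝ (newtonFar 1 2) (x - y)).smulRight (w y)) volume := by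
    intro x
    refine integrable_of_norm_le_weight (continuous_smulRight_comp
      ((hΓ1.continuous_fderiv one_ne_zero).comp (continuous_const.sub continuous_id)) hwc) x ha
      (M := K₁ * A) fun y => ?_
    rw [ContinuousLinearMap.norm_smulRight_apply]
    calc ‖fderiv ℝ (newtonFar 1 2) (x - y)‖ * ‖w y‖
        ≤ K₁ * ((1 + ‖x - y‖) ^ 2)⁻¹ * (A * ((‖y‖ + a) ^ 3)⁻¹) :=
          mul_le_mul (hb1 _) (hwb y) (norm_nonneg _) (by positivity)
      _ = K₁ * A * (((1 + ‖x - y‖) ^ 2)⁻¹ * ((‖y‖ + a) ^ 3)⁻¹) := by ring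
  have hI2 : ∀ x b, Integrable (fun y => (fderiv ℝ (kb b) (x - y)).smulRight (w y)) volume := by
    intro x b
    refine integrable_of_norm_le_weight (continuous_smulRight_comp
      (((hkb b).continuous_fderiv one_ne_zero).comp (continuous_const.sub continuous_id)) hwc) x ha
      (M := K₂ * ‖b‖ * A) fun y => ?_
    rw [ContinuousLinearMap.norm_smulRight_apply]
    calc ‖fderiv ℝ (kb b) (x - y)‖ * ‖w y‖
        ≤ K₂ * ‖b‖ * ((1 + ‖x - y‖) ^ 2)⁻¹ * (A * ((‖y‖ + a) ^ 3)⁻¹) :=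
          mul_le_mul (hb2 _ b) (hwb y) (norm_nonneg _) (by positivity)
      _ = K₂ * ‖b‖ * A * (((1 + ‖x - y‖) ^ 2)⁻¹ * ((‖y‖ + a) ^ 3)⁻¹) := by ring
  -- first derivative formula
  have hd0 : Differentiable ℝ ψf := fun x => (L0 x).2.1.differentiableAt
  have hf1 : ∀ x b, fderiv ℝ ψf x b = ∫ y, kb b (x - y) • w y := by
    intro x b
    rw [(L0 x).2.1.fderiv, ContinuousLinearMap.integral_apply (hI1 x)]
    rfl
  have hf1' : ∀ b, (fun x => fderiv ℝ ψf x b) = fun x => ∫ y, kb b (x - y) • w y := fun b =>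
    funext fun x => hf1 x b
  -- the applied first derivatives are `C¹`
  have hC1 : ∀ b, ContDiff ℝ 1 fun x => fderiv ℝ ψf x b := by
    intro b
    rw [hf1', contDiff_one_iff_fderiv]
    refine ⟨fun x => (L1 b x).2.1.differentiableAt, ?_⟩
    have heq : fderiv ℝ (fun x => ∫ y, kb b (x - y) • w y) =
        fun x => ∫ y, (fderiv ℝ (kb b) (x - y)).smulRight (w y) :=
      funext fun x => (L1 b x).2.1.fderiv
    rw [heq]
    exact continuous_iff_continuousAt.2 fun x => (L1 b x).2.2
  have hC2 : ContDiff ℝ 2 ψf := by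
    rw [show (2 : WithTop ℕ∞) = 1 + 1 from rfl, contDiff_succ_iff_fderiv_apply]
    exact ⟨hd0, fun h => absurd h (by decide), hC1⟩
  -- second derivative formula
  have hf2 : ∀ x b c, fderiv ℝ (fun x => fderiv ℝ ψf x b) x c =
      ∫ y, fderiv ℝ (kb b) (x - y) c • w y := by
    intro x b c
    rw [hf1', (L1 b x).2.1.fderiv, ContinuousLinearMap.integral_apply (hI2 x b)]
    rfl
  refine ⟨hC2, hf1, hf2, fun x => ?_⟩
  -- the Laplacian
  set e := EuclideanSpace.basisFun (Fin 3) ℝ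
  rw [laplacian_eq_sum_fderiv_fderiv e hC2 x]
  simp_rw [hf2]
  have hIi : ∀ i, Integrable (fun y => fderiv ℝ (kb (e i)) (x - y) (e i) • w y) volume := fun i =>
    (ContinuousLinearMap.apply ℝ (EuclideanSpace ℝ (Fin 3)) (e i)).integrable_comp (hI2 x (e i))
      |>.congr (Eventually.of_forall fun y => by simp)
  rw [← integral_finsetSum _ fun i _ => hIi i]
  refine integral_congr_ae (Eventually.of_forall fun y => ?_)
  show (∑ i, fderiv ℝ (kb (e i)) (x - y) (e i) • w y) = newtonFarLaplacian 1 2 (x - y) • w y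
  rw [← Finset.sum_smul, newtonFarLaplacian, laplacian_eq_sum_fderiv_fderiv e hΓ (x - y)]

/-! ## The full potential: `ψ = ψ₀ + ψ∞`, `ψ ∈ C²`, `Δψ = w` -/

/-- Change of variables for the near part and for the smoothing term:
`∫ k(x - y) • w(y) dy = ∫ k(z) • w(x - z) dz`, with integrability, for `k ∈ L¹` vanishing off a
ball and `w` continuous. [folklore] -/
theorem integral_kernel_sub_smul_eq_comp_sub {k : (EuclideanSpace ℝ (Fin 3)) → ℝ} {r : ℝ}
    (hk : Integrable k) (hkr : ∀ z, r < ‖z‖ → k z = 0)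
    {w : (EuclideanSpace ℝ (Fin 3)) → (EuclideanSpace ℝ (Fin 3))} (hwc : Continuous w)
    (x : EuclideanSpace ℝ (Fin 3)) :
    Integrable (fun y => k (x - y) • w y) volume ∧
      ∫ y, k (x - y) • w y = ∫ z, k z • w (x - z) := by
  have hnear : Integrable (fun z => k z • w (x - z)) volume := integrable_smul_comp_sub hk hkr hwc x
  have e : (fun y => k (x - y) • w y) = fun y => (fun z => k z • w (x - z)) (x - y) := by
    funext y; simp only [sub_sub_cancel]
  refine ⟨?_, ?_⟩
  · rw [e]; exact hnear.comp_sub_left x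
  · rw [e]; exact integral_sub_left_eq_self (fun z => k z • w (x - z)) volume x

/-- **`ψ = ψ₀ + ψ∞`**: the Newtonian potential of a continuous apex density converges absolutely
and splits into the near part (density side) and the far part (kernel side). [folklore] -/
theorem newtonPotential_eq_near_add_far
    {w : (EuclideanSpace ℝ (Fin 3)) → (EuclideanSpace ℝ (Fin 3))} (hwc : Continuous w)
    {A a : ℝ} (ha : 0 < a) (hA : 0 ≤ A) (hwb : ∀ y, ‖w y‖ ≤ A * ((‖y‖ + a) ^ 3)⁻¹)
    (x : EuclideanSpace ℝ (Fin 3)) :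
    Integrable (fun y => newtonKernel (x - y) • w y) volume ∧
      ∫ y, newtonKernel (x - y) • w y =
        (∫ z, newtonNear 1 2 z • w (x - z)) + ∫ y, newtonFar 1 2 (x - y) • w y := by
  obtain ⟨K₀, K₁, K₂, hK₀, hK₁, -, hb0, hb1, -, -⟩ := exists_newtonFar_kernel_bounds
  have hΓ1 : ContDiff ℝ 1 (newtonFar (1 : ℝ) 2) := contDiff_newtonFar one_pos one_lt_two
  have hfar := (hasFDerivAt_integral_kernel_sub_smul hΓ1 hK₀ hK₁ hb0 hb1 hwc ha hA hwb x).1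
  obtain ⟨hnear, hne⟩ := integral_kernel_sub_smul_eq_comp_sub (integrable_newtonNear zero_le_one
    one_lt_two) (newtonNear_eq_zero_of_lt zero_le_one one_lt_two) hwc x
  have e : (fun y => newtonKernel (x - y) • w y) =
      fun y => newtonNear 1 2 (x - y) • w y + newtonFar 1 2 (x - y) • w y := by
    funext y; rw [← add_smul, newtonNear_add_newtonFar]
  rw [e]
  exact ⟨hnear.add hfar, by rw [integral_add hnear hfar, hne]⟩

/-- **The Newtonian potential of a `C²` apex density is `C²`.** [folklore] -/
theorem contDiff_two_newtonPotential
    {w : (EuclideanSpace ℝ (Fin 3)) → (EuclideanSpace ℝ (Fin 3))} (hw : ContDiff ℝ 2 w)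
    {A a : ℝ} (ha : 0 < a) (hA : 0 ≤ A) (hwb : ∀ y, ‖w y‖ ≤ A * ((‖y‖ + a) ^ 3)⁻¹) :
    ContDiff ℝ 2 (fun x => ∫ y, newtonKernel (x - y) • w y) := by
  have e : (fun x => ∫ y, newtonKernel (x - y) • w y) =
      (fun x => ∫ z, newtonNear 1 2 z • w (x - z)) + fun x => ∫ y, newtonFar 1 2 (x - y) • w y :=
    funext fun x => (newtonPotential_eq_near_add_far hw.continuous ha hA hwb x).2
  rw [e]
  exact (contDiff_integral_smul_comp_sub (integrable_newtonNear zero_le_one one_lt_two)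
    (newtonNear_eq_zero_of_lt zero_le_one one_lt_two) 2 hw).add
    (newtonFar_potential_regularity hw.continuous ha hA hwb).1

/-- **Poisson's equation**: `Δψ = w` for the Newtonian potential `ψ = Γ ⋆ w` of a `C²` apex density
(`Δψ₀ = w - λ ⋆ w` by Green's representation at scale `(1,2)`, `Δψ∞ = λ ⋆ w`;
Gilbarg–Trudinger (2.17), Lemma 4.2). [cite: GilbargTrudinger2001, (2.17)] -/
theorem laplacian_newtonPotential
    {w : (EuclideanSpace ℝ (Fin 3)) → (EuclideanSpace ℝ (Fin 3))} (hw : ContDiff ℝ 2 w)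
    {A a : ℝ} (ha : 0 < a) (hA : 0 ≤ A) (hwb : ∀ y, ‖w y‖ ≤ A * ((‖y‖ + a) ^ 3)⁻¹)
    (x : EuclideanSpace ℝ (Fin 3)) :
    (Δ (fun x => ∫ y, newtonKernel (x - y) • w y)) x = w x := by
  have e : (fun x => ∫ y, newtonKernel (x - y) • w y) =
      (fun x => ∫ z, newtonNear 1 2 z • w (x - z)) + fun x => ∫ y, newtonFar 1 2 (x - y) • w y :=
    funext fun x => (newtonPotential_eq_near_add_far hw.continuous ha hA hwb x).2
  have hn : ContDiff ℝ 2 fun x => ∫ z, newtonNear 1 2 z • w (x - z) :=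
    contDiff_integral_smul_comp_sub (integrable_newtonNear zero_le_one one_lt_two)
      (newtonNear_eq_zero_of_lt zero_le_one one_lt_two) 2 hw
  obtain ⟨hf, -, -, hfΔ⟩ := newtonFar_potential_regularity hw.continuous ha hA hwb
  rw [e, (hn.contDiffAt).laplacian_add hf.contDiffAt,
    laplacian_integral_smul_comp_sub (integrable_newtonNear zero_le_one one_lt_two)
      (newtonNear_eq_zero_of_lt zero_le_one one_lt_two) hw x,
    integral_newtonNear_smul_laplacian_comp_sub hw x, hfΔ x,
    (integral_kernel_sub_smul_eq_comp_sub (integrable_newtonFarLaplacian one_pos one_lt_two)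
      (newtonFarLaplacian_eq_zero_of_lt' zero_le_one one_lt_two) hw.continuous x).2]
  abel

/-- **First derivatives of the potential**:
`∂_b ψ(x) = ∫ Γ₀(z) ∂_b w(x - z) dz + ∫ ∂_bΓ∞(x - y) w(y) dy`. [folklore] -/
theorem fderiv_newtonPotential_apply
    {w : (EuclideanSpace ℝ (Fin 3)) → (EuclideanSpace ℝ (Fin 3))} (hw : ContDiff ℝ 2 w)
    {A a : ℝ} (ha : 0 < a) (hA : 0 ≤ A) (hwb : ∀ y, ‖w y‖ ≤ A * ((‖y‖ + a) ^ 3)⁻¹)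
    (x b : EuclideanSpace ℝ (Fin 3)) :
    fderiv ℝ (fun x => ∫ y, newtonKernel (x - y) • w y) x b =
      (∫ z, newtonNear 1 2 z • fderiv ℝ w (x - z) b) +
        ∫ y, fderiv ℝ (newtonFar 1 2) (x - y) b • w y := by
  have e : (fun x => ∫ y, newtonKernel (x - y) • w y) =
      (fun x => ∫ z, newtonNear 1 2 z • w (x - z)) + fun x => ∫ y, newtonFar 1 2 (x - y) • w y :=
    funext fun x => (newtonPotential_eq_near_add_far hw.continuous ha hA hwb x).2
  have hw1 : ContDiff ℝ 1 w := hw.of_le one_le_two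
  have hn : ContDiff ℝ 2 fun x => ∫ z, newtonNear 1 2 z • w (x - z) :=
    contDiff_integral_smul_comp_sub (integrable_newtonNear zero_le_one one_lt_two)
      (newtonNear_eq_zero_of_lt zero_le_one one_lt_two) 2 hw
  obtain ⟨hf, hf1, -, -⟩ := newtonFar_potential_regularity hw.continuous ha hA hwb
  rw [e, fderiv_add ((hn.differentiable (by norm_num)) x) ((hf.differentiable (by norm_num)) x),
    _root_.add_apply,
    fderiv_integral_smul_comp_sub_apply (integrable_newtonNear zero_le_one one_lt_two)
      (newtonNear_eq_zero_of_lt zero_le_one one_lt_two) hw1 x b, hf1 x b]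

/-- **Second derivatives of the potential**:
`∂_c∂_b ψ(x) = ∫ Γ₀(z) ∂_c∂_b w(x - z) dz + ∫ ∂_c∂_bΓ∞(x - y) w(y) dy`. [folklore] -/
theorem fderiv_fderiv_newtonPotential_apply
    {w : (EuclideanSpace ℝ (Fin 3)) → (EuclideanSpace ℝ (Fin 3))} (hw : ContDiff ℝ 2 w)
    {A a : ℝ} (ha : 0 < a) (hA : 0 ≤ A) (hwb : ∀ y, ‖w y‖ ≤ A * ((‖y‖ + a) ^ 3)⁻¹)
    (x b c : EuclideanSpace ℝ (Fin 3)) :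
    fderiv ℝ (fun x => fderiv ℝ (fun x => ∫ y, newtonKernel (x - y) • w y) x b) x c =
      (∫ z, newtonNear 1 2 z • fderiv ℝ (fun y => fderiv ℝ w y b) (x - z) c) +
        ∫ y, fderiv ℝ (fun z => fderiv ℝ (newtonFar 1 2) z b) (x - y) c • w y := by
  have hw1 : ContDiff ℝ 1 w := hw.of_le one_le_two
  have hwb' : ContDiff ℝ 1 fun y => fderiv ℝ w y b :=
    (hw.fderiv_right (m := 1) le_rfl).clm_apply contDiff_const
  obtain ⟨hf, hf1, hf2, -⟩ := newtonFar_potential_regularity hw.continuous ha hA hwb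
  -- the applied first derivative, as a sum of two `C¹` functions of `x`
  have e1 : (fun x => fderiv ℝ (fun x => ∫ y, newtonKernel (x - y) • w y) x b) =
      (fun x => ∫ z, newtonNear 1 2 z • (fun y => fderiv ℝ w y b) (x - z)) +
        fun x => fderiv ℝ (fun x => ∫ y, newtonFar 1 2 (x - y) • w y) x b := by
    funext x
    rw [fderiv_newtonPotential_apply hw ha hA hwb x b, Pi.add_apply, hf1 x b]
  have hn1 : ContDiff ℝ 1 fun x => ∫ z, newtonNear 1 2 z • (fun y => fderiv ℝ w y b) (x - z) :=
    contDiff_integral_smul_comp_sub (integrable_newtonNear zero_le_one one_lt_two)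
      (newtonNear_eq_zero_of_lt zero_le_one one_lt_two) 1 hwb'
  have hfb : ContDiff ℝ 1 fun x => fderiv ℝ (fun x => ∫ y, newtonFar 1 2 (x - y) • w y) x b :=
    (hf.fderiv_right (m := 1) le_rfl).clm_apply contDiff_const
  rw [e1, fderiv_add ((hn1.differentiable one_ne_zero) x) ((hfb.differentiable one_ne_zero) x),
    _root_.add_apply,
    fderiv_integral_smul_comp_sub_apply (integrable_newtonNear zero_le_one one_lt_two)
      (newtonNear_eq_zero_of_lt zero_le_one one_lt_two) hwb' x c, hf2 x b c]

/-! ## Registered sub-goal (helper stub of `stub_coulombEnergyPackage`) -/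

/-- **Registered helper stub `stub_newtonPotentialPoisson`** (crux stmt-NavierStokesRegularity-11717,
line `finite-energy-log-convexity`, helper of S4-E): the Newtonian potential of a `C²` apex density
is `C²` and solves Poisson's equation, as registered. [folklore] -/
theorem stub_newtonPotentialPoisson :
    ∀ (w : EuclideanSpace ℝ (Fin 3) → EuclideanSpace ℝ (Fin 3)) (A a : ℝ), ContDiff ℝ 2 w →
      0 < a → 0 ≤ A → (∀ y, ‖w y‖ ≤ A * ((‖y‖ + a) ^ 3)⁻¹) →
      ContDiff ℝ 2 (fun x => ∫ y, newtonKernel (x - y) • w y) ∧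
        ∀ x, Laplacian.laplacian (fun x => ∫ y, newtonKernel (x - y) • w y) x = w x :=
  fun _w _A _a hw ha hA hwb =>
    ⟨contDiff_two_newtonPotential hw ha hA hwb, laplacian_newtonPotential hw ha hA hwb⟩

end Summit.NavierStokesRegularity.NavierStokesRegularity.Theorems.RellichScarScarRigidity

end
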